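import Summits.RiemannHypothesis.RiemannHypothesis.Theorems.Splittings.ScrewGradedSparse
import HarnessLib

/-!
# Splittings — screw-function floors on REAL HITTING NODE SETS («ScrewHittingFloor»)

KEY director-rh g12 2026-08-28T00:21:45Z (K) to rh-idea-5 g3; sketch written and farm-checked by the planner
seat rh-idea-5 g3 (HOME `run/shared/lean/pub/ideators/rh-idea-5/g3/ScrewHittingFloor.lean`), to be filed by a
typer keyed by rh-split-lead g9 as ONE `Theorems/Splittings/ScrewHittingFloor.lean`.

`Ψ = zetaScrew` (Suzuki2023 (1.1)).  The graded sparse dictionary of `ScrewGradedSparse`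
(`quasiRH_iff_gradedFloor_on_dense`: node sets `log A`, `A ⊆ ℕ` `(C, θ)`-dense, `θ < 1`) uses the node
set ONLY through the HIT property «every late window `[t₀, t₀ + e^{−δ t₀}]` contains a node».  This file
states the dictionary directly for an arbitrary real node set `S ⊆ ℝ` (nodes `s ≥ 0`) with that property:

* `gradedQuasiRH_of_hitting`, `quasiRH_iff_gradedFloor_on_hitting` (grade `η ≥ 0`): if
  `∀ t₀ ≥ T, ∃ s ∈ S, t₀ ≤ s ≤ t₀ + e^{−δ t₀}` (`δ > 0`), then
  `QuasiRiemannHypothesis (1/2 + η) ⟺ ∃ K, ∀ s ∈ S, s ≥ 0 → Ψ(s) ≥ −K e^{η s}`;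
* `rh_iff_bddBelow_on_hitting` (grade 0): `RiemannHypothesis ⟺ ∃ K, ∀ s ∈ S, s ≥ 0 → −K ≤ Ψ(s)`;
* `realLogSamples c = {c · log n : n ≥ 1}` and `realLogSamples_hit`: for every real `c > 0` these nodes
  (the samples `x = n^c` of a REAL power; log-gaps `≤ c e^{−t/c}`) hit every window
  `[t₀, t₀ + e^{−t₀/(2c)}]`, `t₀ ≥ 2c²`;
* `rh_iff_bddBelow_realDilation (hc : 0 < c) : RiemannHypothesis ⟺ ∃ K, ∀ n ≥ 1, −K ≤ Ψ(c · log n)`,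
  the RH-free direction `rh_of_bddBelow_realDilation`, and the graded row
  `quasiRH_iff_gradedFloor_realDilation` (`QRH(1/2+η) ⟺ ∃ K, ∀ n ≥ 1, Ψ(c log n) ≥ −K e^{ηc log n} = −K n^{cη}`).

So EVERY real-power sampling `x = n^c`, `c > 0`, of Suzuki's screw criterion is RH-detecting — `c = 4` is
route L41's `SparseScrewLandau.QuarticSampleLandau` (stmt-RiemannHypothesis-23405, closed by a prime-side
chord proof), `c ∈ ℕ` is `ScrewGradedSparse.rh_iff_bddBelow_on_dense` with `ScrewWindowRise.powers_dense`,
rational `c = p/q` reduces to `c = p` (`{c log m^q} = {log m^p}`), irrational `c` is new as a statement — all by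
the zero-side ½-Hölder WINDOW-RISE law (`ScrewWindowRise.windowRise_of_strip`) + the sup abscissa
(`exists_supAbscissa`) + Ω-DEPTH (`ScrewGradedFloor.stub_omegaDepth`), reused BY NAME; no prime-side input,
no Dirichlet series, no chord.  The proof of `gradedQuasiRH_of_hitting` is `ScrewGradedSparse.gradedQuasiRH_of`
with the two dense-set lines replaced by the hit hypothesis; (⟹) of the dictionary is the tree's continuum
graded floor `ScrewGradedFloor.quasiRH_iff_exp_floor` restricted to `S`.

HONEST LABEL: «zero-side generalization of the tree criterion `rh_iff_bddBelow_on_dense`; DEDUP INSTRUMENT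
for Landau siblings (LANDAU SIBLING RULE member 0); RH-free DICTIONARY rows between an open location
hypothesis and open (graded) floors, plus RH-EQUIVALENT relabellings at grade 0; NOT RH-free width, toward
RH 0.  Nothing here bears on the truth of RH.»
-/

set_option linter.dupNamespace false

noncomputable section

open Complex Filter Set

namespace Summit.RiemannHypothesis.RiemannHypothesis.Theorems.Splittings.ScrewHittingFloor

open Literature.NumberTheory.LFunctions
open Summit.RiemannHypothesis.RiemannHypothesis.Theorems.Splittings.ScrewWindowRise

/-! ## 1. Graded detection on a hitting node set -/

/-- **GRADED DETECTION ON A HITTING NODE SET.**  If every window `[t₀, t₀ + e^{−δt₀}]`, `t₀ ≥ T`,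
contains a node of `S`, then a graded floor `Ψ(s) ≥ −K e^{ηs}` on the nodes `s ∈ S`, `s ≥ 0`, forces
`QuasiRiemannHypothesis (1/2 + η)`. -/
theorem gradedQuasiRH_of_hitting {η : ℝ} (hη : 0 ≤ η) (S : Set ℝ) {δ T : ℝ} (hδ : 0 < δ)
    (hhit : ∀ t₀ : ℝ, T ≤ t₀ → ∃ s ∈ S, t₀ ≤ s ∧ s ≤ t₀ + Real.exp (-(δ * t₀)))
    (K : ℝ) (hfloor : ∀ s ∈ S, 0 ≤ s → -K * Real.exp (η * s) ≤ zetaScrew s) :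
    QuasiRiemannHypothesis (1 / 2 + η) := by
  intro s₀ hs₀ h1₀ h2₀
  have h1₀' : 1 / 2 < s₀.re := by linarith
  -- the sup abscissa Θ > 1/2 + η and the strip it defines
  obtain ⟨Θ, hΘhalf, -, hzle, hsup⟩ := exists_supAbscissa hs₀ h1₀' h2₀
  have hΘη : 1 / 2 + η < Θ := lt_of_lt_of_le h1₀ (hzle s₀ hs₀ h1₀' h2₀)
  have hstrip := strip_of_abscissa_le hΘhalf.le hzle
  obtain ⟨B, hB0, hB⟩ := windowRise_of_strip hstrip
  -- δ' ≤ δ/2, δ' ≤ (Θ − 1/2 − η)/2, δ' > 0; depth grade η₁ := Θ − 1/2 − δ' ≥ η ≥ 0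
  obtain ⟨δ', hδ'pos, hδ'leδ, hδ'leg⟩ :
      ∃ δ' : ℝ, 0 < δ' ∧ δ' ≤ δ / 2 ∧ δ' ≤ (Θ - 1 / 2 - η) / 2 := by
    refine ⟨min δ (Θ - 1 / 2 - η) / 2, ?_, ?_, ?_⟩
    · have : 0 < min δ (Θ - 1 / 2 - η) := lt_min hδ (by linarith)
      positivity
    · have := min_le_left δ (Θ - 1 / 2 - η); linarith
    · have := min_le_right δ (Θ - 1 / 2 - η); linarith
  have hη1 : η ≤ Θ - 1 / 2 - δ' := by linarith
  have hη10 : 0 ≤ Θ - 1 / 2 - δ' := hη.trans hη1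
  have hzero : ∃ ρ : ℂ, riemannZeta ρ = 0 ∧ 1 / 2 + (Θ - 1 / 2 - δ') < ρ.re ∧ ρ.re < 1 := by
    obtain ⟨ρ, hρ, hyρ, -, hρ2⟩ := hsup (Θ - δ') (by linarith)
    exact ⟨ρ, hρ, by linarith, hρ2⟩
  -- a deep negative value beyond max T 1, with K₁ := B e^{Θ − 1/2} + (|K| + 1) e^{η}  (Ω-DEPTH, tree)
  obtain ⟨t₀, hTt₀', ht₀0, hdeep⟩ :=
    ScrewGradedFloor.stub_omegaDepth (Θ - 1 / 2 - δ') hη10 hzero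
      (B * Real.exp (Θ - 1 / 2) + (|K| + 1) * Real.exp η) (max T 1)
  have hTt₀ : T ≤ t₀ := (le_max_left T 1).trans hTt₀'
  have hL1 : Real.exp (-(δ * t₀)) ≤ 1 := by
    rw [Real.exp_le_one_iff]
    have := mul_nonneg hδ.le ht₀0
    linarith
  have hLsq : Real.exp (-(δ * t₀)) = Real.exp (-(δ * t₀) / 2) ^ 2 := by
    rw [sq, ← Real.exp_add]
    congr 1
    ring
  have hkey : Real.exp ((Θ - 1 / 2) * (t₀ + 1)) * Real.exp (-(δ * t₀) / 2) ≤
      Real.exp (Θ - 1 / 2) * Real.exp ((Θ - 1 / 2 - δ') * t₀) := by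
    rw [← Real.exp_add, ← Real.exp_add]
    apply Real.exp_le_exp.2
    have hprod : δ' * t₀ ≤ δ / 2 * t₀ := mul_le_mul_of_nonneg_right hδ'leδ ht₀0
    linarith
  -- on the window [t₀, t₀ + e^{−δ t₀}]: Ψ(t) < −(|K|+1) e^{η} e^{η₁ t₀}  (WINDOW-RISE LAW, tree)
  have hneg : ∀ t : ℝ, t₀ ≤ t → t ≤ t₀ + Real.exp (-(δ * t₀)) →
      zetaScrew t < -((|K| + 1) * Real.exp η) * Real.exp ((Θ - 1 / 2 - δ') * t₀) := by
    intro t h1t h2t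
    have hrise := hB t₀ t ht₀0 h1t
    have httL : t - t₀ ≤ Real.exp (-(δ * t₀)) := by linarith
    have ht1 : t ≤ t₀ + 1 := by linarith
    have hroot : Real.sqrt (t - t₀) ≤ Real.exp (-(δ * t₀) / 2) := by
      rw [Real.sqrt_le_left (Real.exp_pos _).le, ← hLsq]
      exact httL
    have hcoef : 0 ≤ Θ - 1 / 2 := by linarith
    have hexp1 : Real.exp ((Θ - 1 / 2) * t) ≤ Real.exp ((Θ - 1 / 2) * (t₀ + 1)) :=
      Real.exp_le_exp.2 (mul_le_mul_of_nonneg_left ht1 hcoef)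
    have hr1 : B * Real.exp ((Θ - 1 / 2) * t) * Real.sqrt (t - t₀) ≤
        B * Real.exp ((Θ - 1 / 2) * (t₀ + 1)) * Real.exp (-(δ * t₀) / 2) := by
      apply mul_le_mul (mul_le_mul_of_nonneg_left hexp1 hB0) hroot (Real.sqrt_nonneg _)
      exact mul_nonneg hB0 (Real.exp_pos _).le
    have hr2 : B * Real.exp ((Θ - 1 / 2) * (t₀ + 1)) * Real.exp (-(δ * t₀) / 2) ≤
        B * (Real.exp (Θ - 1 / 2) * Real.exp ((Θ - 1 / 2 - δ') * t₀)) := by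
      rw [mul_assoc]
      exact mul_le_mul_of_nonneg_left hkey hB0
    have habs := le_abs_self (zetaScrew t - zetaScrew t₀)
    have hE : 0 < Real.exp ((Θ - 1 / 2 - δ') * t₀) := Real.exp_pos _
    nlinarith [hrise, hr1, hr2, hdeep, hE, habs]
  -- the node set has a node s in the window; there the floor −K e^{η s} ≤ Ψ(s) is violated
  obtain ⟨s, hsS, h1s, h2s⟩ := hhit t₀ hTt₀
  have hs0 : 0 ≤ s := ht₀0.trans h1s
  have hs1 : s ≤ t₀ + 1 := by linarith
  -- e^{η s} ≤ e^{η (t₀+1)} = e^{η} e^{η t₀} ≤ e^{η} e^{η₁ t₀}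
  have hpow : Real.exp (η * s) ≤ Real.exp η * Real.exp ((Θ - 1 / 2 - δ') * t₀) := by
    rw [← Real.exp_add]
    apply Real.exp_le_exp.2
    have e1 : η * s ≤ η * (t₀ + 1) := mul_le_mul_of_nonneg_left hs1 hη
    have e2 : η * t₀ ≤ (Θ - 1 / 2 - δ') * t₀ := mul_le_mul_of_nonneg_right hη1 ht₀0
    linarith
  have hpow0 : 0 < Real.exp (η * s) := Real.exp_pos _
  have hfl := hfloor s hsS hs0
  have hv := hneg s h1s h2s
  have hK : K ≤ |K| := le_abs_self K
  have hK1 : 0 ≤ |K| + 1 := by positivity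
  nlinarith [hfl, hv, hpow, hpow0, hK, hK1, Real.exp_pos η]

/-- **THE GRADED DICTIONARY ON A HITTING NODE SET** (`η ≥ 0`):
`QuasiRiemannHypothesis (1/2 + η) ⟺ ∃ K, ∀ s ∈ S, s ≥ 0 → Ψ(s) ≥ −K e^{η s}`.
(⟹) is the tree's continuum graded floor `ScrewGradedFloor.quasiRH_iff_exp_floor` restricted to `S`. -/
theorem quasiRH_iff_gradedFloor_on_hitting {η : ℝ} (hη : 0 ≤ η) (S : Set ℝ) {δ T : ℝ} (hδ : 0 < δ)
    (hhit : ∀ t₀ : ℝ, T ≤ t₀ → ∃ s ∈ S, t₀ ≤ s ∧ s ≤ t₀ + Real.exp (-(δ * t₀))) :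
    QuasiRiemannHypothesis (1 / 2 + η) ↔
      ∃ K : ℝ, ∀ s ∈ S, 0 ≤ s → -K * Real.exp (η * s) ≤ zetaScrew s := by
  constructor
  · intro hq
    obtain ⟨K, hK⟩ := (ScrewGradedFloor.quasiRH_iff_exp_floor hη).1 hq
    exact ⟨K, fun s _ hs ↦ hK s hs⟩
  · rintro ⟨K, hK⟩
    exact gradedQuasiRH_of_hitting hη S hδ hhit K hK

/-- **Grade 0: RH ⟺ `Ψ` BOUNDED BELOW on a hitting node set.** -/
theorem rh_iff_bddBelow_on_hitting (S : Set ℝ) {δ T : ℝ} (hδ : 0 < δ)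
    (hhit : ∀ t₀ : ℝ, T ≤ t₀ → ∃ s ∈ S, t₀ ≤ s ∧ s ≤ t₀ + Real.exp (-(δ * t₀))) :
    _root_.RiemannHypothesis ↔ ∃ K : ℝ, ∀ s ∈ S, 0 ≤ s → -K ≤ zetaScrew s := by
  have e : QuasiRiemannHypothesis (1 / 2) ↔ _root_.RiemannHypothesis :=
    quasiRiemannHypothesis_one_half_iff_holds
  have h := quasiRH_iff_gradedFloor_on_hitting le_rfl S hδ hhit
  simp only [add_zero, zero_mul, Real.exp_zero, mul_one] at h
  rw [← e]
  exact h

/-! ## 2. The samples of a real power: nodes `c · log n`, `n ≥ 1`, `c > 0` -/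

/-- The node set of the real-power sampling `x = n^c`: `{c · log n : n ≥ 1}`. -/
def realLogSamples (c : ℝ) : Set ℝ := {s | ∃ n : ℕ, 1 ≤ n ∧ s = c * Real.log n}

/-- **The nodes `c · log n` hit every window `[t₀, t₀ + e^{−t₀/(2c)}]`, `t₀ ≥ 2c²`** (`c > 0`):
with `n = ⌈e^{t₀/c}⌉` one has `t₀ ≤ c log n < t₀ + c e^{−t₀/c} ≤ t₀ + e^{−t₀/(2c)}`. -/
theorem realLogSamples_hit {c : ℝ} (hc : 0 < c) :
    ∀ t₀ : ℝ, 2 * c * c ≤ t₀ →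
      ∃ s ∈ realLogSamples c, t₀ ≤ s ∧ s ≤ t₀ + Real.exp (-(1 / (2 * c) * t₀)) := by
  intro t₀ ht₀
  have hc0 : 0 ≤ c := hc.le
  have ht₀0 : 0 ≤ t₀ := le_trans (by positivity) ht₀
  set x : ℝ := Real.exp (t₀ / c) with hx
  have hx0 : 0 < x := Real.exp_pos _
  have hx1 : 1 ≤ x := by
    rw [hx, Real.one_le_exp_iff]
    positivity
  set n : ℕ := ⌈x⌉₊ with hn
  have hnx : x ≤ (n : ℝ) := Nat.le_ceil x
  have hnx' : (n : ℝ) < x + 1 := Nat.ceil_lt_add_one hx0.le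
  have hn0 : (0 : ℝ) < n := hx0.trans_le hnx
  have hn1 : 1 ≤ n := by
    have : (1 : ℝ) ≤ n := hx1.trans hnx
    exact_mod_cast this
  refine ⟨c * Real.log n, ⟨n, hn1, rfl⟩, ?_, ?_⟩
  · -- t₀ = c log x ≤ c log n
    have hlog : Real.log x ≤ Real.log n := Real.log_le_log hx0 hnx
    have hlx : Real.log x = t₀ / c := by rw [hx, Real.log_exp]
    rw [hlx] at hlog
    have := mul_le_mul_of_nonneg_left hlog hc0
    rwa [mul_div_cancel₀ _ hc.ne'] at this
  · -- c log n < c log (x+1) ≤ c (log x + 1/x) = t₀ + c e^{−t₀/c} ≤ t₀ + e^{−t₀/(2c)}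
    have hlogn : Real.log n ≤ Real.log (x + 1) := Real.log_le_log hn0 hnx'.le
    have hx1x : x + 1 ≤ x * Real.exp (1 / x) := by
      have h := Real.add_one_le_exp (1 / x)
      have : x * (1 / x + 1) = x + 1 := by field_simp; ring
      nlinarith [mul_le_mul_of_nonneg_left h hx0.le]
    have hlogx1 : Real.log (x + 1) ≤ t₀ / c + 1 / x := by
      calc Real.log (x + 1) ≤ Real.log (x * Real.exp (1 / x)) :=
            Real.log_le_log (by linarith) hx1x
        _ = Real.log x + 1 / x := by
            rw [Real.log_mul hx0.ne' (Real.exp_pos _).ne']; simp only [Real.log_exp]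
        _ = t₀ / c + 1 / x := by rw [hx, Real.log_exp]
    -- 1/x = e^{−t₀/c} and c e^{−t₀/c} ≤ e^{−t₀/(2c)} since c ≤ e^{c} ≤ e^{t₀/(2c)}
    have hinv : 1 / x = Real.exp (-(t₀ / c)) := by rw [hx, Real.exp_neg]; field_simp
    have hhalf : Real.exp (-(t₀ / c)) = Real.exp (-(1 / (2 * c) * t₀)) * Real.exp (-(1 / (2 * c) * t₀)) := by
      rw [← Real.exp_add]; congr 1; field_simp; ring
    have hcexp : c ≤ Real.exp (1 / (2 * c) * t₀) := by
      have h1 : c ≤ 1 / (2 * c) * t₀ := by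
        rw [div_mul_eq_mul_div, le_div_iff₀ (by positivity)]; nlinarith
      exact h1.trans ((by linarith [Real.add_one_le_exp (1 / (2 * c) * t₀)]))
    have hE : 0 < Real.exp (-(1 / (2 * c) * t₀)) := Real.exp_pos _
    have hEE : Real.exp (1 / (2 * c) * t₀) * Real.exp (-(1 / (2 * c) * t₀)) = 1 := by
      rw [← Real.exp_add]; simp
    have hcE : c * Real.exp (-(1 / (2 * c) * t₀)) ≤ 1 := by
      calc c * Real.exp (-(1 / (2 * c) * t₀)) ≤ Real.exp (1 / (2 * c) * t₀) * Real.exp (-(1 / (2 * c) * t₀)) :=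
            mul_le_mul_of_nonneg_right hcexp hE.le
        _ = 1 := hEE
    have hmain : c * Real.log n ≤ c * (t₀ / c + 1 / x) :=
      mul_le_mul_of_nonneg_left (hlogn.trans hlogx1) hc0
    have hsplit : c * (t₀ / c + 1 / x) = t₀ + c * Real.exp (-(t₀ / c)) := by
      rw [hinv, mul_add, mul_div_cancel₀ _ hc.ne']
    rw [hsplit, hhalf] at hmain
    nlinarith [hmain, hcE, hE]

/-- **REAL DILATIONS: RH ⟺ `Ψ(c · log n)` BOUNDED BELOW over `n ≥ 1`, for EVERY real `c > 0`** (the screw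
criterion sampled at `x = n^c`; `c = 4`: route L41's `QuarticSampleLandau` ∧ `QuarticSampleFloor`; `c ∈ ℕ`:
`ScrewGradedSparse.rh_iff_bddBelow_on_dense` with the `c`-th powers).  ⟸ is RH-free detection. -/
theorem rh_iff_bddBelow_realDilation {c : ℝ} (hc : 0 < c) :
    _root_.RiemannHypothesis ↔
      ∃ K : ℝ, ∀ n : ℕ, 1 ≤ n → -K ≤ zetaScrew (c * Real.log n) := by
  have h := rh_iff_bddBelow_on_hitting (realLogSamples c) (by positivity : (0 : ℝ) < 1 / (2 * c))
    (realLogSamples_hit hc)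
  rw [h]
  constructor
  · rintro ⟨K, hK⟩
    refine ⟨K, fun n hn ↦ hK _ ⟨n, hn, rfl⟩ ?_⟩
    exact mul_nonneg hc.le (Real.log_nonneg (by exact_mod_cast hn))
  · rintro ⟨K, hK⟩
    refine ⟨K, ?_⟩
    rintro s ⟨n, hn, rfl⟩ _
    exact hK n hn

/-- **RH-FREE DETECTION at the samples of any real power** (the «Dirichlet sample Landau» statement,
∀ c > 0): a floor `Ψ(c log n) ≥ −K` (`n ≥ 1`) implies RH. -/
theorem rh_of_bddBelow_realDilation {c : ℝ} (hc : 0 < c)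
    (h : ∃ K : ℝ, ∀ n : ℕ, 1 ≤ n → -K ≤ zetaScrew (c * Real.log n)) :
    _root_.RiemannHypothesis :=
  (rh_iff_bddBelow_realDilation hc).2 h

/-- **Graded form at the samples of a real power** (`η ≥ 0`, `c > 0`):
`QuasiRiemannHypothesis (1/2 + η) ⟺ ∃ K, ∀ n ≥ 1, Ψ(c log n) ≥ −K e^{η c log n}` (`= −K n^{cη}`). -/
theorem quasiRH_iff_gradedFloor_realDilation {η : ℝ} (hη : 0 ≤ η) {c : ℝ} (hc : 0 < c) :
    QuasiRiemannHypothesis (1 / 2 + η) ↔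
      ∃ K : ℝ, ∀ n : ℕ, 1 ≤ n → -K * Real.exp (η * (c * Real.log n)) ≤ zetaScrew (c * Real.log n) := by
  have h := quasiRH_iff_gradedFloor_on_hitting hη (realLogSamples c)
    (by positivity : (0 : ℝ) < 1 / (2 * c)) (realLogSamples_hit hc)
  rw [h]
  constructor
  · rintro ⟨K, hK⟩
    refine ⟨K, fun n hn ↦ hK _ ⟨n, hn, rfl⟩ ?_⟩
    exact mul_nonneg hc.le (Real.log_nonneg (by exact_mod_cast hn))
  · rintro ⟨K, hK⟩
    refine ⟨K, ?_⟩
    rintro s ⟨n, hn, rfl⟩ _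
    exact hK n hn

end Summit.RiemannHypothesis.RiemannHypothesis.Theorems.Splittings.ScrewHittingFloor

end
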